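import Literature.AnabelianGeometry.EtaleTheta.Discharge.Sec2SymmetryProofs

/-!
# [EtTh] Prop 2.14 (ii) REDUCED to the extension of the difference cocycle (proof-only companion)

Mochizuki, *The Étale Theta Function …* [EtTh], Publ. RIMS 45 (2009), §2, Prop 2.14 (ii), PRIMS
text pp.49–51 (locators `p.N` = PDF pages; bib key `MochizukiEtTh2009`): for `t^Θ` a
`K^×, (l·ℤ)`-conjugate of `s^Θ`, "the difference `δ = t^Θ − s^Θ` … extends to a cocycle of
`Π^tp_Y`", so the shift `α_δ ∈ Aut(Π^tp_Y[μ_N])` carries `s^Θ` to `t^Θ`, induces the identity on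
`Π^tp_Y`, `μ_N`, and preserves `D_Y`.

PROOF-ONLY companion of `ThetaRigidity.lean` (seat abc-iut-L2-t2), unit W2-L2-06 / Cor 2.18
(abc-iut-L2-t10). Main result `RigidData.prop214_ii_of_gal_extension`: the named fact
`RigidData.Prop214_ii` FOLLOWS, by induction over the `K^×, (l·ℤ)`-conjugacy relation
`ThetaEnvData.IsKLConjugate`, from the single printed input

* `hgal` : for every cocycle `η` of the collection and every `x ∈ Π^tp_X`, the difference cocycle
  `g ↦ η(g) · (x·η)(g)⁻¹` on `Π^tp_Ÿ` (`(x·η)(g) = χ(x) η(x⁻¹ g x)`) EXTENDS to a continuous cocycle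
  `ρ` of `Π^tp_Y` whose shift `α_ρ` normalises `D_Y` (the `Gal(Y/X)`-generator case of Prop 2.14
  (ii); geometric content: Prop 1.5 / the quasi-periodicity of the theta function).

The Kummer step is formal (cocycles inflated from `G_K` are already defined on `Π^tp_Y`), and shifts
compose (`CycEnvelope.shift_mul`); the `x`-conjugate of an extended cocycle is again one
(`isEnvCocycle_conjX`, `shift_conjX`). Together with `cor218_ii_of_prop214_ii`
(`Sec2RigidityProofs`): `hgal ⊢ Prop 2.14 (ii) ⊢ Cor 2.18 (ii)`.
-/

namespace Literature.AnabelianGeometry.EtaleTheta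

universe u

/-- Conjugation by an element of a subgroup maps the subgroup onto itself.
[cite: MochizukiEtTh2009, Def 2.13(i) p.47] -/
theorem subgroup_map_conj_eq_self_of_mem {G : Type*} [Group G] (H : Subgroup G) {h : G}
    (hh : h ∈ H) : H.map (MulAut.conj h).toMonoidHom = H := by
  refine le_antisymm ?_ fun k hk => ?_
  · rintro _ ⟨k, hk, rfl⟩
    change h * k * h⁻¹ ∈ H
    exact H.mul_mem (H.mul_mem hh hk) (H.inv_mem hh)
  · refine ⟨h⁻¹ * k * h, H.mul_mem (H.mul_mem (H.inv_mem hh) hk) hh, ?_⟩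
    change h * (h⁻¹ * k * h) * h⁻¹ = k
    group

/-- `Subgroup.map` along a product of automorphisms. [cite: MochizukiEtTh2009, Def 2.13(i) p.47] -/
theorem subgroup_map_mulAut_mul {G : Type*} [Group G] (A B : MulAut G) (H : Subgroup G) :
    H.map (A * B).toMonoidHom = (H.map B.toMonoidHom).map A.toMonoidHom := by
  rw [Subgroup.map_map]
  rfl

/-- If conjugation by `a` and by `b` both map `H` onto itself, so does conjugation by `a * b` and by
`a⁻¹`. [cite: MochizukiEtTh2009, Def 2.13(i) p.47] -/
theorem subgroup_map_conj_mul_inv {G : Type*} [Group G] (H : Subgroup G) {a b : G}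
    (ha : H.map (MulAut.conj a).toMonoidHom = H) (hb : H.map (MulAut.conj b).toMonoidHom = H) :
    H.map (MulAut.conj (a * b)).toMonoidHom = H ∧ H.map (MulAut.conj a⁻¹).toMonoidHom = H := by
  refine ⟨by rw [map_mul, subgroup_map_mulAut_mul, hb, ha], ?_⟩
  have h := congrArg (Subgroup.map (MulAut.conj a⁻¹).toMonoidHom) ha
  rw [← subgroup_map_mulAut_mul, ← map_mul, inv_mul_cancel, map_one] at h
  rw [← h]
  exact Subgroup.map_id H

namespace ThetaEnvData

variable {N : ℕ+} (T : ThetaEnvData.{u} N)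

/-- The `x`-conjugate `g ↦ χ(x)·δ(x⁻¹ g x)` of a cocycle `δ` of `Π^tp_Y` is a cocycle (the action of
`Gal(Y/X) = Π^tp_X/Π^tp_Y` on `H¹(Π^tp_Y, μ_N)`). [cite: MochizukiEtTh2009, Prop 2.14(ii) p.49] -/
theorem isEnvCocycle_conjX (x : T.PiX) {δ : T.PiY → T.mu}
    (hδ : CycEnvelope.IsEnvCocycle T.augY T.chi δ) :
    CycEnvelope.IsEnvCocycle T.augY T.chi fun g : T.PiY =>
      T.chi (T.aug x) (δ ⟨x⁻¹ * g * x, by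
        simpa [mul_assoc] using T.PiY_normal.conj_mem _ g.2 x⁻¹⟩) := by
  intro g h
  have hmul : (⟨x⁻¹ * ((g * h : T.PiY) : T.PiX) * x, by
        simpa [mul_assoc] using T.PiY_normal.conj_mem _ (g * h).2 x⁻¹⟩ : T.PiY) =
      ⟨x⁻¹ * (g : T.PiX) * x, by simpa [mul_assoc] using T.PiY_normal.conj_mem _ g.2 x⁻¹⟩ *
      ⟨x⁻¹ * (h : T.PiX) * x, by simpa [mul_assoc] using T.PiY_normal.conj_mem _ h.2 x⁻¹⟩ := by
    apply Subtype.ext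
    change x⁻¹ * ((g : T.PiX) * h) * x = x⁻¹ * g * x * (x⁻¹ * h * x)
    group
  have key : T.chi (T.aug x) * T.chi (T.augY ⟨x⁻¹ * (g : T.PiX) * x, by
        simpa [mul_assoc] using T.PiY_normal.conj_mem _ g.2 x⁻¹⟩) =
      T.chi (T.augY g) * T.chi (T.aug x) := by
    rw [← map_mul, ← map_mul]
    congr 1
    change T.aug x * T.aug (x⁻¹ * (g : T.PiX) * x) = T.aug (g : T.PiX) * T.aug x
    rw [map_mul, map_mul, map_inv]
    group
  simp only
  rw [hmul, hδ, map_mul]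
  congr 1
  rw [← MulAut.mul_apply, key, MulAut.mul_apply]

/-- The shift by the `x`-conjugate cocycle is the `conjX x`-conjugate of the shift:
`α_{x·δ} = conj_x ∘ α_δ ∘ conj_x⁻¹`. [cite: MochizukiEtTh2009, Prop 2.14(ii) p.49] -/
theorem shift_conjX (x : T.PiX) {δ : T.PiY → T.mu}
    (hδ : CycEnvelope.IsEnvCocycle T.augY T.chi δ) :
    CycEnvelope.shift (T.isEnvCocycle_conjX x hδ) = T.conjX x * CycEnvelope.shift hδ * (T.conjX x)⁻¹ := by
  ext y
  · simp only [CycEnvelope.shift_apply, MulAut.mul_apply, MulAut.inv_apply, conjX,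
      MulEquiv.symm_mk, MulEquiv.coe_mk, Equiv.coe_fn_symm_mk, Equiv.coe_fn_mk, map_mul]
    rw [← MulAut.mul_apply, ← map_mul, ← map_mul, mul_inv_cancel, map_one, map_one,
      MulAut.one_apply]
  · simp only [CycEnvelope.shift_apply, MulAut.mul_apply, MulAut.inv_apply, conjX,
      MulEquiv.symm_mk, MulEquiv.coe_mk, Equiv.coe_fn_symm_mk, Equiv.coe_fn_mk]
    group

/-- The class of a Kummer shift lies in `D_Y`, so conjugation by it preserves `D_Y`.
[cite: MochizukiEtTh2009, Def 2.13(i) p.47] -/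
theorem DY_map_conj_shift {δ : T.G → T.mu}
    (hδ : CycEnvelope.IsEnvCocycle T.augY T.chi (δ ∘ T.augY))
    (hc : CycEnvelope.shift hδ ∈ contMulAut T.env) :
    T.DY.map (MulAut.conj (TopOut.mk _ ⟨_, hc⟩)).toMonoidHom = T.DY :=
  subgroup_map_conj_eq_self_of_mem _ (Subgroup.subset_closure (Or.inl ⟨δ, hδ, hc, rfl⟩))

/-- The class of `conjX x` lies in `D_Y`, so conjugation by it preserves `D_Y`.
[cite: MochizukiEtTh2009, Def 2.13(i) p.47] -/
theorem DY_map_conj_conjX (x : T.PiX) :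
    T.DY.map (MulAut.conj (TopOut.mk _ ⟨_, T.conjX_mem_contMulAut x⟩)).toMonoidHom = T.DY :=
  subgroup_map_conj_eq_self_of_mem _
    (Subgroup.subset_closure (Or.inr ⟨x, T.conjX_mem_contMulAut x, rfl⟩))

end ThetaEnvData

namespace RigidData

variable {N : ℕ+} {l : ℕ} (R : RigidData.{u} N l)

/-- **Prop 2.14 (ii) DISCHARGED modulo the extension of the difference cocycle** (`hgal`): for
every `K^×, (l·ℤ)`-conjugate `t^Θ` of `s^Θ_η` there is a continuous cocycle `δ` of `Π^tp_Y` with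
`α_δ ∘ s^Θ_η = t^Θ` and `α_δ` normalising `D_Y` — by induction over `IsKLConjugate`: the Kummer step
multiplies `δ` by the inflated cocycle, the `Gal(Y/X)` step conjugates `δ` by `x` and multiplies by
the extension `ρ` supplied by `hgal`. [cite: MochizukiEtTh2009, Prop 2.14(ii) p.49] -/
theorem prop214_ii_of_gal_extension
    (hgal : ∀ (η : R.PiYdd → R.mu) (_ : η ∈ R.thetaCocycles) (x : R.PiX),
      ∃ (ρ : R.PiY → R.mu) (hρ : CycEnvelope.IsEnvCocycle R.augY R.chi ρ)
        (hc : CycEnvelope.shift hρ ∈ contMulAut R.env),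
        (∀ g : R.PiYdd, ρ (R.inclYdd g) = η g * (R.chi (R.aug x) (η ⟨x⁻¹ * g * x, by
          simpa [mul_assoc] using R.PiYdd_normal.conj_mem _ g.2 x⁻¹⟩))⁻¹) ∧
        R.DY.map (MulAut.conj (TopOut.mk _ ⟨_, hc⟩)).toMonoidHom = R.DY) :
    R.Prop214_ii := by
  intro η hη t ht
  induction ht with
  | base =>
    have hc : CycEnvelope.shift (CycEnvelope.isEnvCocycle_one R.augY R.chi) ∈ contMulAut R.env := by
      rw [CycEnvelope.shift_one]; exact one_mem _
    refine ⟨1, CycEnvelope.isEnvCocycle_one R.augY R.chi, hc, fun g => ?_, ?_⟩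
    · rw [CycEnvelope.shift_one]; rfl
    · have h1 : (⟨_, hc⟩ : contMulAut R.env) = 1 := Subtype.ext (CycEnvelope.shift_one _ _)
      rw [h1, map_one]
      exact subgroup_map_conj_eq_self_of_mem _ (one_mem _)
  | kummer t δ hδ hc _ ih =>
    obtain ⟨δ₀, hδ₀, hc₀, hs₀, hD₀⟩ := ih
    have hc' : CycEnvelope.shift (hδ.mul hδ₀) ∈ contMulAut R.env := by
      rw [CycEnvelope.shift_mul hδ hδ₀]; exact mul_mem hc hc₀
    refine ⟨_, hδ.mul hδ₀, hc', fun g => ?_, ?_⟩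
    · rw [CycEnvelope.shift_mul hδ hδ₀, MulAut.mul_apply, hs₀]
    · have he : (⟨_, hc'⟩ : contMulAut R.env) = ⟨_, hc⟩ * ⟨_, hc₀⟩ :=
        Subtype.ext (CycEnvelope.shift_mul hδ hδ₀)
      rw [he, map_mul]
      exact (subgroup_map_conj_mul_inv _ (R.toThetaEnvData.DY_map_conj_shift hδ hc) hD₀).1
  | gal t x _ ih =>
    obtain ⟨δ₀, hδ₀, hc₀, hs₀, hD₀⟩ := ih
    obtain ⟨ρ, hρ, hcρ, hρeq, hDρ⟩ := hgal η hη x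
    have hδx := R.toThetaEnvData.isEnvCocycle_conjX x hδ₀
    have hcx : CycEnvelope.shift hδx ∈ contMulAut R.env := by
      rw [R.toThetaEnvData.shift_conjX x hδ₀]
      exact mul_mem (mul_mem (R.toThetaEnvData.conjX_mem_contMulAut x) hc₀)
        (inv_mem (R.toThetaEnvData.conjX_mem_contMulAut x))
    have hc' : CycEnvelope.shift (hρ.mul hδx) ∈ contMulAut R.env := by
      rw [CycEnvelope.shift_mul hρ hδx]; exact mul_mem hcρ hcx
    refine ⟨_, hρ.mul hδx, hc', fun g => ?_, ?_⟩
    · dsimp only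
      rw [CycEnvelope.shift_mul hρ hδx, MulAut.mul_apply, ← hs₀]
      ext
      · simp only [CycEnvelope.shift_apply, ThetaEnvData.sTheta, MonoidHom.coe_mk, OneHom.coe_mk,
          ThetaEnvData.conjX, MulEquiv.coe_mk, Equiv.coe_fn_mk, map_mul, map_inv, hρeq]
        rw [mul_assoc, mul_comm (R.chi (R.aug x) _), ← mul_assoc, ← mul_assoc, inv_mul_cancel,
          one_mul]
        rfl
      · simp only [CycEnvelope.shift_apply, ThetaEnvData.sTheta, MonoidHom.coe_mk, OneHom.coe_mk,
          ThetaEnvData.conjX, MulEquiv.coe_mk, Equiv.coe_fn_mk, Subgroup.coe_inclusion]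
        group
    · have he : (⟨_, hc'⟩ : contMulAut R.env) =
          ⟨_, hcρ⟩ * (⟨_, R.toThetaEnvData.conjX_mem_contMulAut x⟩ * ⟨_, hc₀⟩ *
            ⟨_, R.toThetaEnvData.conjX_mem_contMulAut x⟩⁻¹) := by
        apply Subtype.ext
        change CycEnvelope.shift (hρ.mul hδx) = _
        rw [CycEnvelope.shift_mul hρ hδx, R.toThetaEnvData.shift_conjX x hδ₀]
        rfl
      rw [he, map_mul]
      refine (subgroup_map_conj_mul_inv _ hDρ ?_).1
      have hm : TopOut.mk _ ((⟨_, R.toThetaEnvData.conjX_mem_contMulAut x⟩ : contMulAut R.env) *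
            ⟨_, hc₀⟩ * ⟨_, R.toThetaEnvData.conjX_mem_contMulAut x⟩⁻¹) =
          TopOut.mk _ ⟨_, R.toThetaEnvData.conjX_mem_contMulAut x⟩ * TopOut.mk _ ⟨_, hc₀⟩ *
            (TopOut.mk _ ⟨_, R.toThetaEnvData.conjX_mem_contMulAut x⟩)⁻¹ := by
        rw [map_mul, map_mul, map_inv]
      rw [hm]
      have hx := R.toThetaEnvData.DY_map_conj_conjX x
      exact (subgroup_map_conj_mul_inv _ (subgroup_map_conj_mul_inv _ hx hD₀).1
        (subgroup_map_conj_mul_inv _ hx hx).2).1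

end RigidData

end Literature.AnabelianGeometry.EtaleTheta
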